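import Mathlib
import HarnessLib
import Literature.Analysis.FluidPDE.VectorCalculus
import Literature.Analysis.FluidPDE.NSBoundedSpatialHolder
import Summits.NavierStokesRegularity.NavierStokesRegularity.Theorems.PoloidalWindowDoorPoloidalWindowRigidityClebschVorticity
import Summits.NavierStokesRegularity.NavierStokesRegularity.Theorems.PoloidalWindowDoorPoloidalWindowRigidityClebsch
import Summits.NavierStokesRegularity.NavierStokesRegularity.Theorems.PoloidalWindowDoorPoloidalWindowRigidityClebschDynamics

/-!
# Route `PoloidalWindowDoor` (staged, nsreg-p1), crux `PoloidalWindowRigidity` (K2) — the global unsteady head: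
# the closed 1-form `v₂ dψ − T dx₂` (nsreg-p1's «d(v₃dψ − T dx₃) = 0») has a primitive on `ℝ³`

Cell ns-regularity-ideate, seat p7 (lead on K2; route-directed support for the open stub `stub_nonflatLiouville`,
to be landed `--supports <PoloidalWindowRigidity item>` once the route is born); sixth Clebsch file.

* GENERIC: the derivative of the `1`-form `g dψ − T dx₂` (`fderiv_headForm_apply`) and **closed ⇒ exact**
  (`exists_headPotential`): if the planar bracket `{ψ, g}_h` vanishes and `∂ᵢT = ∂₂ψ∂ᵢg − ∂₂g∂ᵢψ` (`i = 0,1`), the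
  form is closed (the three independent components of `dg∧dψ − dT∧dx₂`), hence exact on the convex set `ℝ³` by
  Mathlib's Poincaré lemma `Convex.exists_forall_hasFDerivAt_of_fderiv_symmetric`.
* CLASS (`exists_head_slice`): under EXACTLY the hypotheses of `stub_nonflatLiouville`, with the time-dependent
  line potential `φ`, `ψ = v₂ − ∂₂φ`, `T = ∂ₜψ + (v·∇)ψ − Δψ`: for every `t < 0` there is `H` with
  `DH = v₂ Dψ − T dx₂` — i.e. **`∇_h H = v₂∇_hψ` and `T = v₂∂₂ψ − ∂₂H` exactly** (the frozen bracket
  `…Clebsch.frozen_bracket` and (E2) `…ClebschDynamics.clebsch_T_equation` are precisely the closedness conditions).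
  This is nsreg-p1's (E2) «d(v₃dψ − T dx₃) = 0» in integrated form and sharpens `…ClebschPsiEquation` (no
  `c(x₂,t)`): the stream function obeys `∂ₜψ + ∇_hφ·∇_hψ − Δψ + ∂₂H = 0`.

WHAT THIS IS NOT: not a claim about Navier–Stokes regularity and not a proof of K2 — kernel bookkeeping for a
STAGED door route's open stub (bears_on LADDER-NS N0, rung N0-LocalTubeDoorPoloidal).
-/

noncomputable section

-- the summit and its single sub-problem share the name (CONVENTIONS §1), as in every Theorems file
set_option linter.dupNamespace false

namespace Summit.NavierStokesRegularity.NavierStokesRegularity.Theorems.PoloidalWindowDoorPoloidalWindowRigidityClebschHead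

open Set Function
open scoped RealInnerProductSpace InnerProductSpace ContDiff
open Literature.Analysis Literature.Analysis.FluidPDE
open Summit.NavierStokesRegularity.NavierStokesRegularity.Theorems.PoloidalWindowDoorPoloidalWindowRigidityClebschVorticity
open Summit.NavierStokesRegularity.NavierStokesRegularity.Theorems.PoloidalWindowDoorPoloidalWindowRigidityClebsch
open Summit.NavierStokesRegularity.NavierStokesRegularity.Theorems.PoloidalWindowDoorPoloidalWindowRigidityClebschDynamics
open Summit.NavierStokesRegularity.NavierStokesRegularity.Theorems.LocalSineTubeDoorProfileAlignedWindowRigidityAncient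
open Literature.Analysis.FluidPDE.VerticalVorticityFree

/-! ### Generic: `g dψ − T dx₂` is closed iff the frozen bracket and (E2) hold; then it is exact -/

section Generic

variable {g ψ T : EuclideanSpace ℝ (Fin 3) → ℝ}

/-- The derivative of the `1`-form `ω(y) = g(y) dψ(y) − T(y) dx₂`:
`D(p)[x][y] = Dg(p)[x] Dψ(p)[y] + g(p) D²ψ(p)[x][y] − DT(p)[x] y₂` (`dx₂ = ⟪e₂, ·⟫ = innerSL ℝ e₂`). -/
theorem fderiv_headForm_apply (hg : ContDiff ℝ ∞ g) (hψ : ContDiff ℝ ∞ ψ) (hT : ContDiff ℝ 1 T)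
    (p x y : EuclideanSpace ℝ (Fin 3)) :
    fderiv ℝ (fun z => g z • fderiv ℝ ψ z - T z • (innerSL ℝ (EuclideanSpace.single (2 : Fin 3) (1 : ℝ)))) p x y =
      fderiv ℝ g p x * fderiv ℝ ψ p y + g p * fderiv ℝ (fderiv ℝ ψ) p x y - fderiv ℝ T p x * y 2 := by
  have hgd : HasFDerivAt g (fderiv ℝ g p) p := ((hg.differentiable (by simp)) p).hasFDerivAt
  have hTd : HasFDerivAt T (fderiv ℝ T p) p := ((hT.differentiable one_ne_zero) p).hasFDerivAt
  have hLd : HasFDerivAt (fderiv ℝ ψ) (fderiv ℝ (fderiv ℝ ψ) p) p :=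
    (((hψ.fderiv_right (m := 1) (by norm_cast)).differentiable one_ne_zero) p).hasFDerivAt
  have h1 := hgd.smul hLd
  have h2 := hTd.smul_const (innerSL ℝ (EuclideanSpace.single (2 : Fin 3) (1 : ℝ)))
  have h3 := h1.sub h2
  rw [show (fun z => g z • fderiv ℝ ψ z - T z • (innerSL ℝ (EuclideanSpace.single (2 : Fin 3) (1 : ℝ)))) =
      (g • fderiv ℝ ψ - fun z => T z • (innerSL ℝ (EuclideanSpace.single (2 : Fin 3) (1 : ℝ)))) from rfl,
    h3.fderiv]
  simp only [_root_.sub_apply, _root_.add_apply, _root_.smul_apply, ContinuousLinearMap.smulRight_apply,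
    smul_eq_mul]
  have : (innerSL ℝ (EuclideanSpace.single (2 : Fin 3) (1 : ℝ))) y = y 2 := by
    rw [innerSL_apply_apply, EuclideanSpace.inner_single_left]; simp
  rw [this]
  ring

/-- **Closedness ⇒ exactness for the head form.** If `g, ψ` are smooth, `T` is `C¹`, the planar Poisson bracket
vanishes (`∂₁ψ ∂₀g − ∂₀ψ ∂₁g = 0`) and `∂ᵢT = ∂₂ψ ∂ᵢg − ∂₂g ∂ᵢψ` for `i = 0, 1`, then the `1`-form
`g dψ − T dx₂` is closed, hence exact on the convex set `ℝ³` (Mathlib's Poincaré lemma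
`Convex.exists_forall_hasFDerivAt_of_fderiv_symmetric`): there is `H` with `DH(y) = g(y) Dψ(y) − T(y) dx₂`,
i.e. `∂₀H = g∂₀ψ`, `∂₁H = g∂₁ψ`, `∂₂H = g∂₂ψ − T`. -/
theorem exists_headPotential (hg : ContDiff ℝ ∞ g) (hψ : ContDiff ℝ ∞ ψ) (hT : ContDiff ℝ 1 T)
    (hbr : ∀ y, fderiv ℝ ψ y (EuclideanSpace.single 1 1) * fderiv ℝ g y (EuclideanSpace.single 0 1) -
      fderiv ℝ ψ y (EuclideanSpace.single 0 1) * fderiv ℝ g y (EuclideanSpace.single 1 1) = 0)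
    (hE0 : ∀ y, fderiv ℝ T y (EuclideanSpace.single 0 1) =
      fderiv ℝ ψ y (EuclideanSpace.single 2 1) * fderiv ℝ g y (EuclideanSpace.single 0 1) -
        fderiv ℝ g y (EuclideanSpace.single 2 1) * fderiv ℝ ψ y (EuclideanSpace.single 0 1))
    (hE1 : ∀ y, fderiv ℝ T y (EuclideanSpace.single 1 1) =
      fderiv ℝ ψ y (EuclideanSpace.single 2 1) * fderiv ℝ g y (EuclideanSpace.single 1 1) -
        fderiv ℝ g y (EuclideanSpace.single 2 1) * fderiv ℝ ψ y (EuclideanSpace.single 1 1)) :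
    ∃ H : EuclideanSpace ℝ (Fin 3) → ℝ, ∀ y,
      HasFDerivAt H (g y • fderiv ℝ ψ y - T y • (innerSL ℝ (EuclideanSpace.single (2 : Fin 3) (1 : ℝ)))) y := by
  set frm : EuclideanSpace ℝ (Fin 3) → (EuclideanSpace ℝ (Fin 3) →L[ℝ] ℝ) := fun z =>
    g z • fderiv ℝ ψ z - T z • (innerSL ℝ (EuclideanSpace.single (2 : Fin 3) (1 : ℝ))) with hfrm
  have hωd : DifferentiableOn ℝ frm univ := by
    have h : ContDiff ℝ 1 frm :=
      ((hg.of_le (by norm_cast)).smul (hψ.fderiv_right (m := 1) (by norm_cast))).sub (hT.smul contDiff_const)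
    exact (h.differentiable one_ne_zero).differentiableOn
  have hsymm : ∀ a ∈ (univ : Set (EuclideanSpace ℝ (Fin 3))), ∀ x y, fderiv ℝ frm a x y = fderiv ℝ frm a y x := by
    intro a _ x y
    rw [hfrm, fderiv_headForm_apply hg hψ hT, fderiv_headForm_apply hg hψ hT]
    have hψ2 : ContDiff ℝ 2 ψ := hψ.of_le (by norm_cast)
    have hs2 : fderiv ℝ (fderiv ℝ ψ) a x y = fderiv ℝ (fderiv ℝ ψ) a y x :=
      (hψ2.contDiffAt (x := a)).isSymmSndFDerivAt (by simp) x y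
    rw [hs2, clf_apply_eq_sum3 (fderiv ℝ g a) x, clf_apply_eq_sum3 (fderiv ℝ g a) y,
      clf_apply_eq_sum3 (fderiv ℝ ψ a) x, clf_apply_eq_sum3 (fderiv ℝ ψ a) y,
      clf_apply_eq_sum3 (fderiv ℝ T a) x, clf_apply_eq_sum3 (fderiv ℝ T a) y]
    simp only [Fin.sum_univ_three]
    rw [hE0 a, hE1 a]
    linear_combination (x 0 * y 1 - x 1 * y 0) * hbr a
  obtain ⟨H, hH⟩ := (convex_univ : Convex ℝ (univ : Set (EuclideanSpace ℝ (Fin 3)))).exists_forall_hasFDerivAt_of_fderiv_symmetric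
    isOpen_univ hωd hsymm
  exact ⟨H, fun y => hH y (mem_univ y)⟩

end Generic


/-! ### The class version: the global unsteady head of a poloidal Type-I profile -/

section Profile

open MeasureTheory Filter Topology
open scoped Laplacian

variable {C : ℝ} {v : ℝ → EuclideanSpace ℝ (Fin 3) → EuclideanSpace ℝ (Fin 3)}

/-- **The global head potential.** Under EXACTLY the hypotheses of `stub_nonflatLiouville` (class, poloidality along
`e₂`, frozen constraint), with the time-dependent horizontal line potential `φ`, stream function `ψ = v₂ − ∂₂φ` and
`T := ∂ₜψ + (v·∇)ψ − Δψ`: for every `t < 0` the `1`-form `v₂ dψ − T dx₂` is exact on `ℝ³` — there is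
`H : ℝ³ → ℝ` with `DH(y) = v₂(y) Dψ(y) − T(y) dx₂`, i.e. `∇_h H = v₂ ∇_h ψ` and `T = v₂ ∂₂ψ − ∂₂H` EXACTLY
(nsreg-p1 R9-PREP §(1): «(E2) d(v₃dψ − T dx₃) = 0»; `H` = the unsteady Bernoulli head `∂ₜφ + p + |v|²/2 − Δφ`
up to a function of `t`, an identification not needed here). Consequently the ψ-equation reads
`∂ₜψ + ∇_hφ·∇_hψ − Δψ + ∂₂H = 0`. -/
theorem exists_head_slice (hrate : HasTypeITimeDecay C v)
    (hcont : ContinuousOn (uncurry v) (Iio (0 : ℝ) ×ˢ univ))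
    (hmild : ∀ s t : ℝ, s < t → t < 0 → ∀ x,
      v t x = UnboundedOperators.heatExtension (v s) (t - s) x - oseenDuhamel 1 s v v t x)
    (hdiv : ∀ t < 0, VectorCalculus.IsDivFree (v t))
    (hpol : ∀ s < 0, ∀ y, ⟪curl (v s) y, EuclideanSpace.single 2 1⟫_ℝ = 0)
    (hfi : ∀ s < 0, ∀ y, ⟪fderiv ℝ (v s) y (curl (v s) y), EuclideanSpace.single 2 1⟫_ℝ = 0)
    {φ ψ : ℝ → EuclideanSpace ℝ (Fin 3) → ℝ}
    (hφ : φ = fun (t : ℝ) (x : EuclideanSpace ℝ (Fin 3)) =>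
      ∫ σ in (0 : ℝ)..1, ⟪v t (σ • (x - x 2 • (EuclideanSpace.single (2 : Fin 3) (1 : ℝ))) +
        x 2 • (EuclideanSpace.single (2 : Fin 3) (1 : ℝ))), x - x 2 • (EuclideanSpace.single (2 : Fin 3) (1 : ℝ))⟫_ℝ)
    (hψ : ψ = fun t y => v t y 2 - fderiv ℝ (φ t) y (EuclideanSpace.single 2 1))
    {t : ℝ} (ht : t < 0) :
    ∃ H : EuclideanSpace ℝ (Fin 3) → ℝ, ∀ y,
      HasFDerivAt H ((v t y 2) • fderiv ℝ (ψ t) y -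
        (deriv (fun s => ψ s y) t + (convect (v t) (ψ t) y - (Δ (ψ t)) y)) •
          (innerSL ℝ (EuclideanSpace.single (2 : Fin 3) (1 : ℝ)))) y := by
  have hsm : ContDiffOn ℝ ∞ (uncurry v) (Iio (0 : ℝ) ×ˢ univ) :=
    (analyticOnNhd_uncurry hcont (bdd_of_hasTypeITimeDecay hrate) hmild).contDiffOn_of_completeSpace
  have hS : UniqueDiffOn ℝ (Iio (0 : ℝ)) := isOpen_Iio.uniqueDiffOn
  have hV : ContDiff ℝ ∞ (v t) := IsSmoothSpaceTimeOn.contDiff_slice hsm ht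
  have hc2 : ∀ z, curl (v t) z 2 = 0 := fun z => curl_two_eq_zero hpol ht z
  have hφt : φ t = fun x : EuclideanSpace ℝ (Fin 3) =>
      ∫ σ in (0 : ℝ)..1, ⟪v t (σ • (x - x 2 • (EuclideanSpace.single (2 : Fin 3) (1 : ℝ))) +
        x 2 • (EuclideanSpace.single (2 : Fin 3) (1 : ℝ))), x - x 2 • (EuclideanSpace.single (2 : Fin 3) (1 : ℝ))⟫_ℝ := by
    rw [hφ]
  have hψt : ψ t = fun z => v t z 2 - fderiv ℝ (φ t) z (EuclideanSpace.single 2 1) := by rw [hψ]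
  have hψsl : ContDiff ℝ ∞ (ψ t) := by rw [hψt]; exact contDiff_stream hV hφt
  have hg : ContDiff ℝ ∞ fun z => v t z 2 :=
    (EuclideanSpace.proj (2 : Fin 3) : EuclideanSpace ℝ (Fin 3) →L[ℝ] ℝ).contDiff.comp hV
  -- frozen bracket for the explicit stream function
  have hcomp : ∀ z, curl (v t) z 0 = fderiv ℝ (ψ t) z (EuclideanSpace.single 1 1) ∧
      curl (v t) z 1 = -fderiv ℝ (ψ t) z (EuclideanSpace.single 0 1) ∧ curl (v t) z 2 = 0 := by
    intro z; rw [hψt]; exact curl_apply_eq_fderiv_stream hV hc2 hφt z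
  have hbr : ∀ y, fderiv ℝ (ψ t) y (EuclideanSpace.single 1 1) * fderiv ℝ (fun z => v t z 2) y (EuclideanSpace.single 0 1) -
      fderiv ℝ (ψ t) y (EuclideanSpace.single 0 1) * fderiv ℝ (fun z => v t z 2) y (EuclideanSpace.single 1 1) = 0 := by
    intro y
    rw [fderiv_apply_coord hV, fderiv_apply_coord hV]
    exact frozen_bracket (hfi t ht) hcomp y
  -- `T` is `C¹` (indeed smooth)
  have hψs : IsSmoothSpaceTimeOn (Iio (0 : ℝ)) ψ := by
    have hφs : IsSmoothSpaceTimeOn (Iio (0 : ℝ)) φ := by rw [hφ]; exact contDiffOn_linePotential_uncurry hsm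
    have h1 : ContDiffOn ℝ ∞ (fun q : ℝ × EuclideanSpace ℝ (Fin 3) => (uncurry v) q 2) (Iio (0 : ℝ) ×ˢ univ) :=
      (EuclideanSpace.proj (2 : Fin 3) : EuclideanSpace ℝ (Fin 3) →L[ℝ] ℝ).contDiff.comp_contDiffOn hsm
    have h2 : ContDiffOn ℝ ∞ (fun q : ℝ × EuclideanSpace ℝ (Fin 3) =>
        (uncurry (fun t x => fderiv ℝ (φ t) x)) q (EuclideanSpace.single 2 1)) (Iio (0 : ℝ) ×ˢ univ) :=
      ContDiffOn.clm_apply (show ContDiffOn ℝ ∞ (uncurry fun t x => fderiv ℝ (φ t) x)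
        (Iio (0 : ℝ) ×ˢ univ) from hφs.fderiv_slice hS) contDiffOn_const
    rw [hψ]
    exact (h1.sub h2).congr fun q _ => by rcases q with ⟨s, z⟩; rfl
  have hT : ContDiff ℝ 1 fun z => deriv (fun s => ψ s z) t + (convect (v t) (ψ t) z - (Δ (ψ t)) z) := by
    have h := (IsSmoothSpaceTimeOn.timeDerivWithin hψs hS).contDiff_slice ht
    have e : timeDerivWithin (Iio (0 : ℝ)) ψ t = fun z => deriv (fun s => ψ s z) t := by
      funext z; rw [timeDerivWithin_apply, derivWithin_of_isOpen isOpen_Iio ht]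
    rw [e] at h
    have hdc : ContDiff ℝ ∞ fun z => convect (v t) (ψ t) z := (hψsl.fderiv_right (m := ∞) le_rfl).clm_apply hV
    have hdl : ContDiff ℝ (1 : ℕ∞) (Δ (ψ t)) := contDiff_laplacian (n := 1) (hψsl.of_le (by norm_cast))
    exact (h.of_le (by norm_cast)).add ((hdc.of_le (by norm_cast)).sub hdl)
  -- (E2) literal supplies the two remaining closedness conditions
  have hE := fun y => clebsch_T_equation hrate hcont hmild hdiv hpol hφ hψ ht y
  refine exists_headPotential hg hψsl hT hbr (fun y => ?_) (fun y => ?_)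
  · rw [(hE y).2, fderiv_apply_coord hV, fderiv_apply_coord hV]
  · rw [(hE y).1, fderiv_apply_coord hV, fderiv_apply_coord hV]


/-- **The reduced Clebsch system of a poloidal Type-I profile, packaged.** Under EXACTLY the hypotheses of
`stub_nonflatLiouville` there are `φ ψ : ℝ → ℝ³ → ℝ`, jointly `C^∞` on the slab `(−∞,0) × ℝ³`, such that for every
`t < 0`: `v t = ∇(φ t) + (ψ t) e₂`, `curl (v t) = ∇(ψ t) × e₂`, (E1) `Δ(φ t) + ∂₂(ψ t) = 0`, the frozen bracket
`∂₁ψ ∂₀v₂ − ∂₀ψ ∂₁v₂ = 0`, and there is a head `H` with `DH = v₂ D(ψ t) − T dx₂`,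
`T = ∂ₜψ + (v·∇)ψ − Δψ` ((E2) integrated) — the complete kernel form of nsreg-p1's reduction (R9-PREP §(1)). -/
theorem exists_clebsch_system (hrate : HasTypeITimeDecay C v)
    (hcont : ContinuousOn (uncurry v) (Iio (0 : ℝ) ×ˢ univ))
    (hmild : ∀ s t : ℝ, s < t → t < 0 → ∀ x,
      v t x = UnboundedOperators.heatExtension (v s) (t - s) x - oseenDuhamel 1 s v v t x)
    (hdiv : ∀ t < 0, VectorCalculus.IsDivFree (v t))
    (hpol : ∀ s < 0, ∀ y, ⟪curl (v s) y, EuclideanSpace.single 2 1⟫_ℝ = 0)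
    (hfi : ∀ s < 0, ∀ y, ⟪fderiv ℝ (v s) y (curl (v s) y), EuclideanSpace.single 2 1⟫_ℝ = 0) :
    ∃ φ ψ : ℝ → EuclideanSpace ℝ (Fin 3) → ℝ,
      ContDiffOn ℝ ∞ (uncurry φ) (Iio (0 : ℝ) ×ˢ univ) ∧ ContDiffOn ℝ ∞ (uncurry ψ) (Iio (0 : ℝ) ×ˢ univ) ∧
      ∀ t < 0,
        (∀ y, v t y = gradient (φ t) y + ψ t y • EuclideanSpace.single 2 1) ∧
        (∀ y, curl (v t) y = cross (gradient (ψ t) y) (EuclideanSpace.single 2 1)) ∧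
        (∀ y, (Δ (φ t)) y + fderiv ℝ (ψ t) y (EuclideanSpace.single 2 1) = 0) ∧
        (∀ y, fderiv ℝ (ψ t) y (EuclideanSpace.single 1 1) * fderiv ℝ (v t) y (EuclideanSpace.single 0 1) 2 -
          fderiv ℝ (ψ t) y (EuclideanSpace.single 0 1) * fderiv ℝ (v t) y (EuclideanSpace.single 1 1) 2 = 0) ∧
        ∃ H : EuclideanSpace ℝ (Fin 3) → ℝ, ∀ y,
          HasFDerivAt H ((v t y 2) • fderiv ℝ (ψ t) y -
            (deriv (fun s => ψ s y) t + (convect (v t) (ψ t) y - (Δ (ψ t)) y)) •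
              (innerSL ℝ (EuclideanSpace.single (2 : Fin 3) (1 : ℝ)))) y := by
  have hsm : ContDiffOn ℝ ∞ (uncurry v) (Iio (0 : ℝ) ×ˢ univ) :=
    (analyticOnNhd_uncurry hcont (bdd_of_hasTypeITimeDecay hrate) hmild).contDiffOn_of_completeSpace
  have hS : UniqueDiffOn ℝ (Iio (0 : ℝ)) := isOpen_Iio.uniqueDiffOn
  set φ : ℝ → EuclideanSpace ℝ (Fin 3) → ℝ := fun (t : ℝ) (x : EuclideanSpace ℝ (Fin 3)) =>
    ∫ σ in (0 : ℝ)..1, ⟪v t (σ • (x - x 2 • (EuclideanSpace.single (2 : Fin 3) (1 : ℝ))) +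
      x 2 • (EuclideanSpace.single (2 : Fin 3) (1 : ℝ))), x - x 2 • (EuclideanSpace.single (2 : Fin 3) (1 : ℝ))⟫_ℝ with hφ
  set ψ : ℝ → EuclideanSpace ℝ (Fin 3) → ℝ := fun t y => v t y 2 - fderiv ℝ (φ t) y (EuclideanSpace.single 2 1) with hψ
  have hφs : IsSmoothSpaceTimeOn (Iio (0 : ℝ)) φ := contDiffOn_linePotential_uncurry hsm
  have hψs : IsSmoothSpaceTimeOn (Iio (0 : ℝ)) ψ := by
    have h1 : ContDiffOn ℝ ∞ (fun q : ℝ × EuclideanSpace ℝ (Fin 3) => (uncurry v) q 2) (Iio (0 : ℝ) ×ˢ univ) :=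
      (EuclideanSpace.proj (2 : Fin 3) : EuclideanSpace ℝ (Fin 3) →L[ℝ] ℝ).contDiff.comp_contDiffOn hsm
    have h2 : ContDiffOn ℝ ∞ (fun q : ℝ × EuclideanSpace ℝ (Fin 3) =>
        (uncurry (fun t x => fderiv ℝ (φ t) x)) q (EuclideanSpace.single 2 1)) (Iio (0 : ℝ) ×ˢ univ) :=
      ContDiffOn.clm_apply (show ContDiffOn ℝ ∞ (uncurry fun t x => fderiv ℝ (φ t) x)
        (Iio (0 : ℝ) ×ˢ univ) from hφs.fderiv_slice hS) contDiffOn_const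
    exact (h1.sub h2).congr fun q _ => by rcases q with ⟨s, z⟩; rfl
  refine ⟨φ, ψ, hφs, hψs, fun t ht => ?_⟩
  have hV : ContDiff ℝ ∞ (v t) := IsSmoothSpaceTimeOn.contDiff_slice hsm ht
  have hc2 : ∀ z, curl (v t) z 2 = 0 := fun z => curl_two_eq_zero hpol ht z
  have hφt : φ t = fun x : EuclideanSpace ℝ (Fin 3) =>
      ∫ σ in (0 : ℝ)..1, ⟪v t (σ • (x - x 2 • (EuclideanSpace.single (2 : Fin 3) (1 : ℝ))) +
        x 2 • (EuclideanSpace.single (2 : Fin 3) (1 : ℝ))), x - x 2 • (EuclideanSpace.single (2 : Fin 3) (1 : ℝ))⟫_ℝ := rfl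
  have hψt : ψ t = fun y => v t y 2 - fderiv ℝ (φ t) y (EuclideanSpace.single 2 1) := rfl
  have hcomp' : ∀ z, curl (v t) z 0 = fderiv ℝ (ψ t) z (EuclideanSpace.single 1 1) ∧
      curl (v t) z 1 = -fderiv ℝ (ψ t) z (EuclideanSpace.single 0 1) ∧ curl (v t) z 2 = 0 := by
    intro z; rw [hψt]; exact curl_apply_eq_fderiv_stream hV hc2 hφt z
  have hgrad : ∀ (f : EuclideanSpace ℝ (Fin 3) → ℝ) (x : EuclideanSpace ℝ (Fin 3)) (i : Fin 3),
      gradient f x i = fderiv ℝ f x (EuclideanSpace.single i 1) := by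
    intro f x i
    have e : gradient f x i = ⟪gradient f x, EuclideanSpace.single i (1 : ℝ)⟫_ℝ := by
      rw [EuclideanSpace.inner_single_right]; simp
    rw [e, gradient, InnerProductSpace.toDual_symm_apply]
  have hv0 : ∀ y, fderiv ℝ (φ t) y (EuclideanSpace.single 0 1) = v t y 0 := fun y =>
    fderiv_linePotential_single hV hc2 y (Or.inl rfl)
  have hv1 : ∀ y, fderiv ℝ (φ t) y (EuclideanSpace.single 1 1) = v t y 1 := fun y =>
    fderiv_linePotential_single hV hc2 y (Or.inr rfl)
  have hv2 : ∀ y, v t y 2 = fderiv ℝ (φ t) y (EuclideanSpace.single 2 1) + ψ t y := fun y => by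
    simp only [hψ]; ring
  refine ⟨fun y => ?_, fun y => ?_, fun y => ?_, fun y => ?_,
    exists_head_slice hrate hcont hmild hdiv hpol hfi rfl rfl ht⟩
  · ext i
    fin_cases i
    · simp [hgrad, hv0]
    · simp [hgrad, hv1]
    · simp [hgrad, hv2 y]
  · obtain ⟨c0, c1, c2⟩ := hcomp' y
    ext i
    fin_cases i
    · simp [cross, cross_apply, hgrad, c0]
    · simp [cross, cross_apply, hgrad, c1]
    · simp [cross, cross_apply, c2]
  · rw [← divergence_eq_laplacian_add_fderiv_stream hV hc2 hφt y]; exact hdiv t ht y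
  · exact frozen_bracket (hfi t ht) hcomp' y

end Profile

end Summit.NavierStokesRegularity.NavierStokesRegularity.Theorems.PoloidalWindowDoorPoloidalWindowRigidityClebschHead

end
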